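import Mathlib.RingTheory.NoetherNormalization
import Literature.NumberTheory.Transcendental.ZilberFieldGSGC
import HarnessLib

/-!
# Generic specialisations into an algebraically closed field with room

Let `M` be an algebraically closed field and `k ≤ M` a subfield over which `M` has *room*: for
every `s` there are `s` elements of `M` algebraically independent over `k` (e.g. `k` is contained in
the algebraic closure of a finite set and no finite set spans `M` in the algebraic matroid,
`room_of_forall_finite`). Then

* every affine `k`-domain `A` embeds into `M` over `k` (`exists_injective_algHom`: Noether
  normalisation `k[X₁, …, X_s] ↪ A` integral, Mathlib's `exists_integral_inj_algHom_of_fg`; send the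
  `Xᵢ` to independent elements and extend with `IsAlgClosed.lift`; the extension is injective because
  a prime of `A` lying over `0` in `k[X]` is `0`, `Ideal.eq_bot_of_comap_eq_bot`);
* hence every prime ideal `P ⊆ k[X, Y]` has a generic point in `M`: a zero `z ∈ M^{n ⊕ n}` with
  `I(z/k) = P` (`exists_isGenericPt`, in the sense of `IsGenericPt` of `ExpVarietiesDimension.lean`).

This is the step "take `(x̄, ȳ)` to be a generic point of `V` over (the current finitely generated
field)" of the constructions of exponential fields by adjoining points of varieties (Kirby,
*Finitely presented exponential fields*, A&NT 7 (2013), §3; Bays–Kirby 2018, proof of Lemma 8.3 /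
Prop. 7.3), performed *inside* a fixed algebraically closed field of infinite transcendence degree
rather than in an abstract extension.

## References

* J. Kirby, *Finitely presented exponential fields*, Algebra & Number Theory 7 (2013), §3.
* H. Matsumura, *Commutative ring theory*, Thm 5.6 / §33 (Noether normalisation).
-/

noncomputable section

open MvPolynomial Set

universe u

namespace Literature.NumberTheory.Transcendental

namespace PseudoExpGenericPoint

open GammaField Matroid

section InjectiveHom

variable {M : Type u} [Field M] [IsAlgClosed M]

set_option synthInstance.maxHeartbeats 100000 in
set_option maxHeartbeats 800000 in
/-- **Affine domains over `k` embed into an algebraically closed field with room over `k`.**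
If `A` is a finitely generated `k`-domain, `k ≤ M` a subfield, and `M` contains `s` elements
algebraically independent over `k` for every `s`, then there is an injective `k`-algebra map
`A → M`. [cite: Matsumura1987, Thm 5.6 (Noether normalisation)] -/
theorem exists_injective_algHom (k : Subfield M) (A : Type u) [CommRing A] [IsDomain A]
    [Algebra k A] [Algebra.FiniteType k A]
    (room : ∀ s : ℕ, ∃ t : Fin s → M, AlgebraicIndependent k t) :
    ∃ ψ : A →ₐ[k] M, Function.Injective ψ := by
  classical
  obtain ⟨s, g, hg, hint⟩ := exists_integral_inj_algHom_of_fg k A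
  obtain ⟨t, ht⟩ := room s
  let φ₀ : MvPolynomial (Fin s) k →ₐ[k] M := MvPolynomial.aeval t
  have hφ₀ : Function.Injective φ₀ := (algebraicIndependent_iff_injective_aeval).1 ht
  letI algRA : Algebra (MvPolynomial (Fin s) k) A := g.toRingHom.toAlgebra
  letI algRM : Algebra (MvPolynomial (Fin s) k) M := φ₀.toRingHom.toAlgebra
  haveI : IsScalarTower k (MvPolynomial (Fin s) k) A :=
    IsScalarTower.of_algebraMap_eq fun c => (g.commutes c).symm
  haveI : IsScalarTower k (MvPolynomial (Fin s) k) M :=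
    IsScalarTower.of_algebraMap_eq fun c => (φ₀.commutes c).symm
  haveI : Algebra.IsIntegral (MvPolynomial (Fin s) k) A := ⟨fun a => hint a⟩
  have hgA : Function.Injective (algebraMap (MvPolynomial (Fin s) k) A) := hg
  have hφM : Function.Injective (algebraMap (MvPolynomial (Fin s) k) M) := hφ₀
  haveI : Module.IsTorsionFree (MvPolynomial (Fin s) k) A :=
    Module.isTorsionFree_iff_algebraMap_injective.2 hgA
  haveI : Module.IsTorsionFree (MvPolynomial (Fin s) k) M :=
    Module.isTorsionFree_iff_algebraMap_injective.2 hφM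
  let ψ₀ : A →ₐ[MvPolynomial (Fin s) k] M :=
    IsAlgClosed.lift (R := MvPolynomial (Fin s) k) (S := A) (M := M)
  have hker : RingHom.ker (ψ₀ : A →+* M) = ⊥ := by
    refine Ideal.eq_bot_of_comap_eq_bot (R := MvPolynomial (Fin s) k) ?_
    rw [RingHom.comap_ker, AlgHom.comp_algebraMap]
    exact (RingHom.injective_iff_ker_eq_bot _).1 hφM
  have hψ₀ : Function.Injective ψ₀ := (RingHom.injective_iff_ker_eq_bot (ψ₀ : A →+* M)).2 hker
  exact ⟨ψ₀.restrictScalars k, hψ₀⟩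

/-- **Generic points of prime ideals over `k` in an algebraically closed field with room over `k`**:
for a prime `P ⊆ k[X, Y]` there is `z ∈ M^{n ⊕ n}` with `I(z/k) = P` (`IsGenericPt P z`): embed the
affine domain `k[X, Y]/P` into `M` over `k` and take the image of the classes of the coordinates.
[cite: Kirby2013FPEF, §3 (adjoining a generic point of V)] -/
theorem exists_isGenericPt (k : Subfield M)
    (room : ∀ s : ℕ, ∃ t : Fin s → M, AlgebraicIndependent k t)
    {n : ℕ} (P : Ideal (MvPolynomial (Fin n ⊕ Fin n) k)) [P.IsPrime] :
    ∃ z : Fin n ⊕ Fin n → M, IsGenericPt P z := by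
  classical
  obtain ⟨ψ, hψ⟩ := exists_injective_algHom k (MvPolynomial (Fin n ⊕ Fin n) k ⧸ P) room
  refine ⟨fun j => ψ (Ideal.Quotient.mk P (X j)), fun a => ?_⟩
  have h1 : (aeval fun j => ψ (Ideal.Quotient.mk P (X j))) =
      ψ.comp (Ideal.Quotient.mkₐ k P) :=
    MvPolynomial.algHom_ext fun j => by simp
  rw [h1, AlgHom.comp_apply, Ideal.Quotient.mkₐ_eq_mk, map_eq_zero_iff ψ hψ,
    Ideal.Quotient.eq_zero_iff_mem]

end InjectiveHom

/-! ### Room over a small subfield from room in the algebraic matroid -/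

section Room

variable {M : Type u} [Field M] [CharZero M]

/-- Tuples of prescribed relative rank over a finite set, when no finite set is spanning.
[folklore] -/
theorem exists_tuple_le_relRank (room : ∀ S : Set M, S.Finite → ∃ t : M, t ∉ acl S)
    {S₀ : Set M} (hS₀ : S₀.Finite) :
    ∀ s : ℕ, ∃ t : Fin s → M, (s : ℕ∞) ≤ (algMatroid M).relRank S₀ (range t) := by
  intro s
  induction s with
  | zero => exact ⟨Fin.elim0, by simp⟩
  | succ s ih =>
    obtain ⟨t, ht⟩ := ih
    obtain ⟨u, hu⟩ := room (range t ∪ S₀) ((finite_range t).union hS₀)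
    refine ⟨Fin.snoc t u, ?_⟩
    have hrange : range (Fin.snoc t u : Fin (s + 1) → M) = insert u (range t) := by
      rw [Fin.range_snoc]
    rw [hrange, (algMatroid M).relRank_insert_eq_add_one (mem_univ u) hu]
    push_cast
    exact add_le_add ht le_rfl

/-- **Room over a small subfield**: if no finite set spans `M` in its algebraic matroid and the
subfield `k` is contained in the algebraic closure of a finite set, then for every `s` there are
`s` elements of `M` algebraically independent over `k`. [folklore] -/
theorem room_of_forall_finite (room : ∀ S : Set M, S.Finite → ∃ t : M, t ∉ acl S)
    (k : Subfield M) {S₀ : Set M} (hS₀ : S₀.Finite) (hk : (k : Set M) ⊆ acl S₀) :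
    ∀ s : ℕ, ∃ t : Fin s → M, AlgebraicIndependent k t := by
  intro s
  obtain ⟨t, ht⟩ := exists_tuple_le_relRank room hS₀ s
  have h1 : (s : ℕ∞) ≤ (algMatroid M).relRank (k : Set M) (range t) :=
    calc (s : ℕ∞) ≤ (algMatroid M).relRank S₀ (range t) := ht
      _ = (algMatroid M).relRank ((algMatroid M).closure S₀) (range t) :=
          ((algMatroid M).relRank_closure_left _ _).symm
      _ ≤ (algMatroid M).relRank (k : Set M) (range t) :=
          (algMatroid M).relRank_anti_left _ hk
  obtain ⟨σ, hσ⟩ := ZilberSaturationMain.exists_algebraicIndependent_of_le_relRank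
    (k.toIntermediateField (ZilberGSGC.algebraMap_rat_mem k)) t h1
  exact ⟨t ∘ σ, hσ⟩

end Room

end PseudoExpGenericPoint

end Literature.NumberTheory.Transcendental
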